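import Mathlib
import Summits.NavierStokesRegularity.NavierStokesRegularity.Theorems.TaoLadderRungTwoBreakBlowupRigidityOneClockedFrontExtraction
import Summits.NavierStokesRegularity.NavierStokesRegularity.Theorems.TaoLadderRungTwoBreakBlowupRigidityOneRenormalisedViscousFlow
import HarnessLib

/-!
# The two-sided self-similar clock by re-selection for a VISCOUS front: viscosity only removes energy, so the forward energy
  gain bound of the exact flow survives and the lower clock is free — the viscous twin of `clock_of_front` for the front
  bundle of `stub_eternalFromBlowup` (K2(1) `TaoLadderRungTwoBreak.BlowupRigidityOne`, stmt-NavierStokesRegularity-20206)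

MODEL lattice ODEs only (Tao 2016 §4 (4.8)–(4.9), the viscous equation before Thm. 4.2, §6.4); nothing here is a statement
about the Navier–Stokes equations; NO item is closed (`--supports stmt-NavierStokesRegularity-20206`). Route-independent
(general `m`).

* `energy_gain_le_visc` — for a `ν`-viscous flow (`ν ≥ 0`) under the amplitude ceiling `‖x_j‖ ≤ B ν_r^j`, every shell energy
  GAINS at most `K (Λν_r³)^k (t - s)` on `[s,t] ⊂ [0,T)` (`K = 2B³(s₀₀₀ + Λ⁻¹s₀₀₁ν_r⁻² + (s₁₀₀+s₀₁₀)ν_r)`, the constant of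
  `energy_lipschitz`): the dissipation term `-2ν(1+ε₀)^{2k}‖x_k‖² ≤ 0` is simply dropped (one-sided bound, no ratio condition);
* `clock_of_viscousFront` — floor `c_f(ν_r²)^k ≤ ‖x_k(t_k)‖²` with UPPER clock `(Λ²ν_r²)^k(T-t_k)² ≤ κ₂` + amplitude ceiling +
  `Λν_r ≥ 1` ⇒ re-selected times with floor `c_f/2` and TWO-SIDED clock (pull back by `c₀(Λν_r)^{-k}`; only the forward gain
  bound is used, exactly as in `clock_of_front`).

HONEST LABEL: bookkeeping toward the viscous front bundle; nothing is closed here.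
-/

noncomputable section

-- the summit and its single sub-problem share the name (CONVENTIONS §1)
set_option linter.dupNamespace false

open Set Filter Topology MeasureTheory
open scoped RealInnerProductSpace

namespace Summit.NavierStokesRegularity.NavierStokesRegularity.Theorems

namespace BlowupRigidityOne

open Literature.Analysis.FluidPDE Literature.Analysis.FluidPDE.TaoCascade

variable {m : ℕ}

/-- **FORWARD ENERGY GAIN BOUND FOR A VISCOUS FLOW under the amplitude ceiling.** For a `ν`-viscous flow on `[0,T)` (`ν ≥ 0`)
with `‖x_j(t)‖ ≤ B ν_r^j`, and `0 ≤ s ≤ t < T`, `k ∈ ℕ`: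
`‖x_k(t)‖² - ‖x_k(s)‖² ≤ 2B³(s₀₀₀ + Λ⁻¹s₀₀₁ν_r⁻² + (s₁₀₀+s₀₁₀)ν_r)·(Λν_r³)^k·(t-s)` — the energy identity
`d/dt‖x_k‖² = 2⟪x_k, Λ^k(Q + Λ⁻¹A + B)⟫ - 2ν(1+ε₀)^{2k}‖x_k‖²` with the dissipation dropped.
[cite: Tao2016AveragedNS, §4 (4.8)–(4.9) and the viscous equation before Thm. 4.2; cell vocabulary (`shiftConst`)] -/
theorem energy_gain_le_visc {ε₀ ν T B νr : ℝ} (hε : 0 < ε₀) (hνv : 0 ≤ ν)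
    {α : Fin m → Fin m → Fin m → ℤ × ℤ × ℤ → ℝ}
    {X : Fin m → ℤ → ℝ → ℝ} (hC1 : ∀ i n, ContDiffOn ℝ 1 (X i n) (Set.Ico 0 T))
    (hmot : ∀ i n t, 0 ≤ t → t < T → derivWithin (X i n) (Set.Ici 0) t =
      quadTerm ε₀ α X i n t - ν * (1 + ε₀) ^ ((2 : ℝ) * n) * X i n t)
    (hB : 0 ≤ B) (hν : 0 < νr)
    (hamp : ∀ (j : ℤ) (t : ℝ), 0 ≤ t → t < T → ‖shellVec X j t‖ ≤ B * νr ^ j)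
    (k : ℕ) {s t : ℝ} (hs : 0 ≤ s) (hst : s ≤ t) (ht : t < T) :
    ‖shellVec X (k : ℤ) t‖ ^ 2 - ‖shellVec X (k : ℤ) s‖ ^ 2 ≤
      (2 * B ^ 3 * (shiftConst α (0, 0, 0) + (bigLam ε₀)⁻¹ * shiftConst α (0, 0, 1) * νr⁻¹ ^ 2
        + (shiftConst α (1, 0, 0) + shiftConst α (0, 1, 0)) * νr)) * (bigLam ε₀ * νr ^ 3) ^ k * (t - s) := by
  set K' : ℝ := (2 * B ^ 3 * (shiftConst α (0, 0, 0) + (bigLam ε₀)⁻¹ * shiftConst α (0, 0, 1) * νr⁻¹ ^ 2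
    + (shiftConst α (1, 0, 0) + shiftConst α (0, 1, 0)) * νr)) * (bigLam ε₀ * νr ^ 3) ^ k with hK'
  have hb : (0 : ℝ) < 1 + ε₀ := by linarith
  have hk1 : ∀ u : ℝ, 0 ≤ u → u < T → ‖shellVec X ((k : ℤ) - 1) u‖ ≤ B * (νr ^ k * νr⁻¹) := by
    intro u hu0 huT
    have h := hamp ((k : ℤ) - 1) u hu0 huT
    rwa [zpow_sub_one₀ hν.ne', zpow_natCast] at h
  have hk2 : ∀ u : ℝ, 0 ≤ u → u < T → ‖shellVec X ((k : ℤ) + 1) u‖ ≤ B * (νr ^ k * νr) := by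
    intro u hu0 huT
    have h := hamp ((k : ℤ) + 1) u hu0 huT
    rwa [zpow_add_one₀ hν.ne', zpow_natCast] at h
  have hk0 : ∀ u : ℝ, 0 ≤ u → u < T → ‖shellVec X (k : ℤ) u‖ ≤ B * νr ^ k := by
    intro u hu0 huT
    have h := hamp (k : ℤ) u hu0 huT
    rwa [zpow_natCast] at h
  -- the energy minus the linear bound is antitone on `[s,t]`
  set g : ℝ → ℝ := fun u => ‖shellVec X (k : ℤ) u‖ ^ 2 - K' * u with hg
  have hcontE : ContinuousOn (fun u => ‖shellVec X (k : ℤ) u‖ ^ 2) (Icc s t) :=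
    (((continuousOn_shellVec_of_contDiffOn hC1 (k : ℤ)).norm).pow 2).mono fun u hu => ⟨hs.trans hu.1, lt_of_le_of_lt hu.2 ht⟩
  have hcontg : ContinuousOn g (Icc s t) := hcontE.sub (continuousOn_const.mul continuousOn_id)
  have hderiv : ∀ u ∈ interior (Icc s t), HasDerivWithinAt g
      (2 * ⟪shellVec X (k : ℤ) u, bigLam ε₀ ^ (k : ℤ) • (tableQ α (shellVec X (k : ℤ) u)
        + (bigLam ε₀)⁻¹ • tableA α (shellVec X ((k : ℤ) - 1) u)
        + tableB α (shellVec X ((k : ℤ) + 1) u) (shellVec X (k : ℤ) u))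
        - (ν * (1 + ε₀) ^ ((2 : ℝ) * ((k : ℤ) : ℝ))) • shellVec X (k : ℤ) u⟫ - K') (interior (Icc s t)) u := by
    intro u hu
    rw [interior_Icc] at hu
    have huT : u ∈ Ioo 0 T := ⟨lt_of_le_of_lt hs hu.1, lt_trans hu.2 ht⟩
    have h1 := (hasDerivAt_shellVec_of_viscousFlow hε hC1 hmot (k : ℤ) huT).norm_sq
    have h2 : HasDerivAt (fun v => K' * v) K' u := by simpa using (hasDerivAt_id u).const_mul K'
    exact (h1.sub h2).hasDerivWithinAt
  have hnonpos : ∀ u ∈ interior (Icc s t),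
      2 * ⟪shellVec X (k : ℤ) u, bigLam ε₀ ^ (k : ℤ) • (tableQ α (shellVec X (k : ℤ) u)
        + (bigLam ε₀)⁻¹ • tableA α (shellVec X ((k : ℤ) - 1) u)
        + tableB α (shellVec X ((k : ℤ) + 1) u) (shellVec X (k : ℤ) u))
        - (ν * (1 + ε₀) ^ ((2 : ℝ) * ((k : ℤ) : ℝ))) • shellVec X (k : ℤ) u⟫ - K' ≤ 0 := by
    intro u hu
    rw [interior_Icc] at hu
    have hu0 : 0 ≤ u := hs.trans hu.1.le
    have huT : u < T := lt_trans hu.2 ht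
    have hd : ⟪shellVec X (k : ℤ) u, (ν * (1 + ε₀) ^ ((2 : ℝ) * ((k : ℤ) : ℝ))) • shellVec X (k : ℤ) u⟫
        = (ν * (1 + ε₀) ^ ((2 : ℝ) * ((k : ℤ) : ℝ))) * ‖shellVec X (k : ℤ) u‖ ^ 2 := by
      rw [real_inner_smul_right, real_inner_self_eq_norm_sq]
    rw [inner_sub_right, hd, mul_sub]
    have hmain := abs_energyDeriv_le hε α hB hν (hk0 u hu0 huT) (hk1 u hu0 huT) (hk2 u hu0 huT)
    have h1 : 2 * ⟪shellVec X (k : ℤ) u, bigLam ε₀ ^ (k : ℤ) • (tableQ α (shellVec X (k : ℤ) u)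
        + (bigLam ε₀)⁻¹ • tableA α (shellVec X ((k : ℤ) - 1) u)
        + tableB α (shellVec X ((k : ℤ) + 1) u) (shellVec X (k : ℤ) u))⟫ ≤ K' := by
      rw [hK']; exact (le_abs_self _).trans hmain
    have h2 : 0 ≤ 2 * (ν * (1 + ε₀) ^ ((2 : ℝ) * ((k : ℤ) : ℝ)) * ‖shellVec X (k : ℤ) u‖ ^ 2) := by
      have : 0 < (1 + ε₀) ^ ((2 : ℝ) * ((k : ℤ) : ℝ)) := Real.rpow_pos_of_pos hb _
      positivity
    linarith
  have hanti : AntitoneOn g (Icc s t) :=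
    antitoneOn_of_hasDerivWithinAt_nonpos (convex_Icc s t) hcontg hderiv hnonpos
  have h := hanti (left_mem_Icc.2 hst) (right_mem_Icc.2 hst) hst
  simp only [hg] at h
  rw [hK'] at h
  linarith

/-- **THE TWO-SIDED CLOCK BY RE-SELECTION FOR A VISCOUS FRONT.** As `clock_of_front` (exact flow), for a `ν`-viscous flow
(`ν ≥ 0`): floor `c_f (ν_r²)^k ≤ ‖x_k(t_k)‖²` with upper clock `(Λ²ν_r²)^k (T - t_k)² ≤ κ₂` on every shell, amplitude ceiling
`B ν_r^j`, `Λν_r ≥ 1` ⇒ re-selected times with floor `c_f/2` and two-sided clock `c₀² ≤ (Λ²ν_r²)^k(T-τ_k)² ≤ (√κ₂+c₀)²`.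
Only the forward energy GAIN bound is needed for the pull-back, and viscosity only lowers the gain (`energy_gain_le_visc`).
[cite: Tao2016AveragedNS, §4 (4.8)–(4.10), the viscous equation before Thm. 4.2, §6.4; cell vocabulary] -/
theorem clock_of_viscousFront {ε₀ ν T B νr cf κ₂ : ℝ} (hε : 0 < ε₀) (hT : 0 < T) (hνv : 0 ≤ ν)
    {α : Fin m → Fin m → Fin m → ℤ × ℤ × ℤ → ℝ}
    {X : Fin m → ℤ → ℝ → ℝ} (hC1 : ∀ i n, ContDiffOn ℝ 1 (X i n) (Set.Ico 0 T))
    (hmot : ∀ i n t, 0 ≤ t → t < T → derivWithin (X i n) (Set.Ici 0) t =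
      quadTerm ε₀ α X i n t - ν * (1 + ε₀) ^ ((2 : ℝ) * n) * X i n t)
    (hB : 0 ≤ B) (hν : 0 < νr)
    (hamp : ∀ (j : ℤ) (t : ℝ), 0 ≤ t → t < T → ‖shellVec X j t‖ ≤ B * νr ^ j)
    (hΛν : 1 ≤ bigLam ε₀ * νr) (hcf : 0 < cf) (hκ₂ : 0 < κ₂)
    (hfire : ∀ k : ℕ, ∃ t : ℝ, 0 ≤ t ∧ t < T ∧ cf * (νr ^ 2) ^ k ≤ ‖shellVec X (k : ℤ) t‖ ^ 2 ∧
      (bigLam ε₀ ^ 2 * νr ^ 2) ^ k * (T - t) ^ 2 ≤ κ₂) :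
    ∃ (κ₁ κ₂' : ℝ) (τ : ℕ → ℝ), 0 < κ₁ ∧ 0 < κ₂' ∧ (∀ k : ℕ, 0 ≤ τ k ∧ τ k < T) ∧
      (∀ k : ℕ, cf / 2 * (νr ^ 2) ^ k ≤ ‖shellVec X (k : ℤ) (τ k)‖ ^ 2) ∧
      (∀ k : ℕ, κ₁ ≤ (bigLam ε₀ ^ 2 * νr ^ 2) ^ k * (T - τ k) ^ 2) ∧
      (∀ k : ℕ, (bigLam ε₀ ^ 2 * νr ^ 2) ^ k * (T - τ k) ^ 2 ≤ κ₂') := by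
  have hΛ : 0 < bigLam ε₀ := bigLam_pos (by linarith)
  have hΛi : 0 ≤ (bigLam ε₀)⁻¹ := (inv_pos.2 hΛ).le
  set K : ℝ := 2 * B ^ 3 * (shiftConst α (0, 0, 0) + (bigLam ε₀)⁻¹ * shiftConst α (0, 0, 1) * νr⁻¹ ^ 2
    + (shiftConst α (1, 0, 0) + shiftConst α (0, 1, 0)) * νr) + 1 with hK_def
  have hKnn : 0 ≤ 2 * B ^ 3 * (shiftConst α (0, 0, 0) + (bigLam ε₀)⁻¹ * shiftConst α (0, 0, 1) * νr⁻¹ ^ 2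
      + (shiftConst α (1, 0, 0) + shiftConst α (0, 1, 0)) * νr) := by
    have s0 := shiftConst_nonneg α (0, 0, 0)
    have s1 := shiftConst_nonneg α (0, 0, 1)
    have s2 := shiftConst_nonneg α (1, 0, 0)
    have s3 := shiftConst_nonneg α (0, 1, 0)
    positivity
  have hK1 : 2 * B ^ 3 * (shiftConst α (0, 0, 0) + (bigLam ε₀)⁻¹ * shiftConst α (0, 0, 1) * νr⁻¹ ^ 2
      + (shiftConst α (1, 0, 0) + shiftConst α (0, 1, 0)) * νr) ≤ K := by rw [hK_def]; linarith
  have hK0 : 0 < K := by rw [hK_def]; linarith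
  set ρ : ℝ := bigLam ε₀ * νr with hρ_def
  have hρ : 0 < ρ := by positivity
  have hρk : ∀ k : ℕ, 1 ≤ ρ ^ k := fun k => one_le_pow₀ hΛν
  set c₀ : ℝ := min (cf / (2 * K)) T with hc₀_def
  have hc₀ : 0 < c₀ := lt_min (by positivity) hT
  have hc₀K : c₀ ≤ cf / (2 * K) := min_le_left _ _
  have hc₀T : c₀ ≤ T := min_le_right _ _
  choose tf htf using hfire
  have hδ : ∀ k : ℕ, 0 < c₀ * (ρ ^ k)⁻¹ := fun k => by positivity
  have hδle : ∀ k : ℕ, c₀ * (ρ ^ k)⁻¹ ≤ c₀ := fun k => by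
    have : (ρ ^ k)⁻¹ ≤ 1 := inv_le_one_of_one_le₀ (hρk k)
    calc c₀ * (ρ ^ k)⁻¹ ≤ c₀ * 1 := mul_le_mul_of_nonneg_left this hc₀.le
      _ = c₀ := mul_one _
  refine ⟨c₀ ^ 2, (Real.sqrt κ₂ + c₀) ^ 2, fun k => max (tf k - c₀ * (ρ ^ k)⁻¹) 0, by positivity, by positivity,
    ?_⟩
  have key : ∀ k : ℕ, (0 ≤ max (tf k - c₀ * (ρ ^ k)⁻¹) 0 ∧ max (tf k - c₀ * (ρ ^ k)⁻¹) 0 < T) ∧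
      cf / 2 * (νr ^ 2) ^ k ≤ ‖shellVec X (k : ℤ) (max (tf k - c₀ * (ρ ^ k)⁻¹) 0)‖ ^ 2 ∧
      c₀ ^ 2 ≤ (bigLam ε₀ ^ 2 * νr ^ 2) ^ k * (T - max (tf k - c₀ * (ρ ^ k)⁻¹) 0) ^ 2 ∧
      (bigLam ε₀ ^ 2 * νr ^ 2) ^ k * (T - max (tf k - c₀ * (ρ ^ k)⁻¹) 0) ^ 2 ≤ (Real.sqrt κ₂ + c₀) ^ 2 := by
    intro k
    obtain ⟨ht0, htT, hfl, hupk⟩ := htf k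
    set τ := max (tf k - c₀ * (ρ ^ k)⁻¹) 0 with hτ_def
    have hτ0 : 0 ≤ τ := le_max_right _ _
    have hτle : τ ≤ tf k := max_le (by linarith [hδ k]) ht0
    have hτT : τ < T := lt_of_le_of_lt hτle htT
    have hgap : tf k - τ ≤ c₀ * (ρ ^ k)⁻¹ := by
      have h := le_max_left (tf k - c₀ * (ρ ^ k)⁻¹) 0
      linarith
    have hq : (bigLam ε₀ ^ 2 * νr ^ 2) ^ k = (ρ ^ k) ^ 2 := by
      rw [hρ_def, ← mul_pow, ← pow_mul, ← pow_mul, Nat.mul_comm]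
    -- the floor survives the pull-back (forward gain bound)
    have hgain := energy_gain_le_visc hε hνv hC1 hmot hB hν hamp k hτ0 hτle htT
    have hfloor : cf / 2 * (νr ^ 2) ^ k ≤ ‖shellVec X (k : ℤ) τ‖ ^ 2 := by
      have h1 : ‖shellVec X (k : ℤ) (tf k)‖ ^ 2 - ‖shellVec X (k : ℤ) τ‖ ^ 2 ≤
          K * (bigLam ε₀ * νr ^ 3) ^ k * (c₀ * (ρ ^ k)⁻¹) :=
        hgain.trans (mul_le_mul (mul_le_mul_of_nonneg_right hK1 (by positivity)) hgap (by linarith) (by positivity))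
      have h2 : K * (bigLam ε₀ * νr ^ 3) ^ k * (c₀ * (ρ ^ k)⁻¹) = K * c₀ * (νr ^ 2) ^ k := by
        rw [hρ_def]
        have hρk0 : (bigLam ε₀ * νr) ^ k ≠ 0 := (pow_pos hρ k).ne'
        rw [show (bigLam ε₀ * νr ^ 3) ^ k = (bigLam ε₀ * νr) ^ k * (νr ^ 2) ^ k by
          rw [← mul_pow]; ring]
        field_simp
      have h3 : K * c₀ * (νr ^ 2) ^ k ≤ cf / 2 * (νr ^ 2) ^ k := by
        refine mul_le_mul_of_nonneg_right ?_ (by positivity)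
        calc K * c₀ ≤ K * (cf / (2 * K)) := mul_le_mul_of_nonneg_left hc₀K hK0.le
          _ = cf / 2 := by field_simp
      linarith
    have hlow : c₀ * (ρ ^ k)⁻¹ ≤ T - τ := by
      rcases le_total (tf k - c₀ * (ρ ^ k)⁻¹) 0 with h | h
      · have hτeq : τ = 0 := by rw [hτ_def]; exact max_eq_right h
        rw [hτeq, sub_zero]
        exact (hδle k).trans hc₀T
      · have hτeq : τ = tf k - c₀ * (ρ ^ k)⁻¹ := by rw [hτ_def]; exact max_eq_left h
        rw [hτeq]
        linarith
    have hclock₁ : c₀ ^ 2 ≤ (bigLam ε₀ ^ 2 * νr ^ 2) ^ k * (T - τ) ^ 2 := by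
      rw [hq]
      have h1 : c₀ ≤ ρ ^ k * (T - τ) := by
        have h := mul_le_mul_of_nonneg_left hlow (pow_pos hρ k).le
        have e : ρ ^ k * (c₀ * (ρ ^ k)⁻¹) = c₀ := by field_simp
        rwa [e] at h
      calc c₀ ^ 2 ≤ (ρ ^ k * (T - τ)) ^ 2 := pow_le_pow_left₀ hc₀.le h1 2
        _ = (ρ ^ k) ^ 2 * (T - τ) ^ 2 := by ring
    have hclock₂ : (bigLam ε₀ ^ 2 * νr ^ 2) ^ k * (T - τ) ^ 2 ≤ (Real.sqrt κ₂ + c₀) ^ 2 := by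
      rw [hq]
      have hu1 : ρ ^ k * (T - tf k) ≤ Real.sqrt κ₂ := by
        have h : (ρ ^ k * (T - tf k)) ^ 2 ≤ κ₂ := by
          rw [mul_pow, ← hq]; exact hupk
        exact (le_abs_self _).trans (Real.abs_le_sqrt h)
      have hu2 : ρ ^ k * (T - τ) ≤ ρ ^ k * (T - tf k) + ρ ^ k * (c₀ * (ρ ^ k)⁻¹) := by
        rw [← mul_add]
        exact mul_le_mul_of_nonneg_left (by linarith) (pow_pos hρ k).le
      have hu3 : ρ ^ k * (c₀ * (ρ ^ k)⁻¹) = c₀ := by field_simp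
      have hu4 : ρ ^ k * (T - τ) ≤ Real.sqrt κ₂ + c₀ := by linarith
      have hu0 : 0 ≤ ρ ^ k * (T - τ) := mul_nonneg (pow_pos hρ k).le (by linarith)
      calc (ρ ^ k) ^ 2 * (T - τ) ^ 2 = (ρ ^ k * (T - τ)) ^ 2 := by ring
        _ ≤ (Real.sqrt κ₂ + c₀) ^ 2 := pow_le_pow_left₀ hu0 hu4 2
    exact ⟨⟨hτ0, hτT⟩, hfloor, hclock₁, hclock₂⟩
  exact ⟨fun k => (key k).1, fun k => (key k).2.1, fun k => (key k).2.2.1, fun k => (key k).2.2.2⟩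

end BlowupRigidityOne

end Summit.NavierStokesRegularity.NavierStokesRegularity.Theorems

end
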